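import Literature.Probability.RandomPlanarGeometry.HexSAWBrickWallStripFugacityWidthOneSextic
import Literature.Probability.RandomPlanarGeometry.HexSAWBrickWallStripFugacityWidthOneSexticLower
import HarnessLib

/-!
# The two-fugacity rate of the one-cell honeycomb strip: `μ_1(y,z)²` IS the largest root of `s(s − y)(s − z) = yz`

Topic `Literature/Probability/RandomPlanarGeometry` (assembles `HexSAWBrickWallStripFugacityWidthOneSextic.lean` — the UPPER half
`μ²(μ²−y)(μ²−z) ≤ yz` under `max(y,z) ≤ μ²`, by the row-dependent phase potential — and
`HexSAWBrickWallStripFugacityWidthOneSexticLower.lean` — the LOWER half `yz ≤ μ²(μ²−y)(μ²−z)` and `max(y,z) < μ²`, by two-row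
switch words and the `2 × 2` unit transfer matrix).  Source of the objects: N. R. Beaton, M. Bousquet-Mélou, J. de Gier,
H. Duminil-Copin, A. J. Guttmann, Comm. Math. Phys. 326 (2014) 727–754, arXiv:1109.0358v5, §3.2 Proposition 6 (p. 10): the
two-fugacity rate `μ_T(y,z) = lim_n C_{T,n}(y,z)^{1/n}` of the strip `S_T` (`HexBW.stripMuY₂ T y z`), "finite, and non-decreasing
in `y` and `z`", `μ_T(y,z) = μ_T(z,y)`; Proposition 7 (p. 11): the one-variable rate `μ_T(1,y) = μ_T(y,1)` (`HexBW.stripMuY₀ T y`).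
The paper proves no closed form for any `μ_T`; here `T = 1`.

## Statements (namespace `Literature.Probability.RandomPlanarGeometry.SAW.HexBW`, all PROVED, standard axioms)

For all `y, z > 0`, with `μ = μ_1(y,z) = stripMuY₂ 1 y z` and `s = μ²`:

* ★★★ **`stripMuY₂_one_sq_poly_eq : s(s − y)(s − z) = yz`** and `max_lt_stripMuY₂_one_sq` (previous file): **`μ_1(y,z)²` is the
  unique root of `s(s−y)(s−z) = yz` above `max(y,z)`** (`stripMuY₂_one_sq_eq_of_root`: any such root equals `μ²`;
  `poly_lt_poly_of_lt`: the cubic is strictly increasing there);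
* ★★ usable forms: `stripMuY₂_one_le_iff` (`μ ≤ ρ ↔ yz ≤ ρ²(ρ²−y)(ρ²−z)` for `ρ > 0`, `max(y,z) ≤ ρ²`) and `le_stripMuY₂_one_iff`
  (`ρ ≤ μ ↔ ρ²(ρ²−y)(ρ²−z) ≤ yz`, same hypotheses);
* ★★ **strict monotonicity** `stripMuY₂_one_strictMono_left : y < y' ⇒ μ_1(y,z) < μ_1(y',z)` and `stripMuY₂_one_strictMono_right`
  (the printed Proposition 6 has "non-decreasing"; at `T = 1` the rate is STRICTLY increasing in each fugacity, for all
  `y, z > 0`);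
* one weighted wall (`z = 1`, the printed rate `μ_1(y,1) = stripMuY₀ 1 y`): ★★ **`stripMuY₀_one_sq_poly_eq : s(s − y)(s − 1) = y`**
  for EVERY `y > 0` (`s = μ_1(y,1)²`), `stripMuY₀_one_sq_sub_eq : s − y = y/(s(s−1))`, and the explicit second-order window
  ★ `stripMuY₀_one_sq_mem_Icc : μ_1(y,1)² ∈ [y + 1/(y+1), y + 1/(y−1)]` for `y ≥ 2` — so `μ_1(y,1)² = y + 1/y + O(1/y²)`, the
  same second-order coefficient as the half-plane law of the lane (`HexSAWSurfaceSecondOrderSharp`, a-p6);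
* at `z = y`: `stripMuY₂_one_self_sq_poly_eq` re-derives `μ_1(y,y)³ = yμ_1(y,y) + y` (`HexSAWBrickWallStripFugacityWidthOneExact`)
  from the sextic, as a consistency check;
* ★★ **the one-cell slit versus every wider strip at UNEQUAL wall weights** (extends Part D of `…WidthOneExact`, `z = y ≥ 9`):
  `stripMuY₂_lt_one_of_three_le` — `y ≥ 25`, `6 ≤ z ≤ y` ⇒ `μ_T(y,z) < μ_1(y,z)` for every `T ≥ 3`; `stripMuY₂_lt_one_of_two_le` —
  `y ≥ 25`, `5√y ≤ z ≤ y` ⇒ the same for every `T ≥ 2`; primed versions with the walls exchanged;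
* ★ explicit envelopes for all `y, z > 0`: `max(y,z) + yz/((max+√min)(max−min+√min)) < μ_1(y,z)² < max(y,z) + √min(y,z)`
  (`max_add_lt_stripMuY₂_one_sq`, `stripMuY₂_one_sq_lt_max_add_sqrt_min`).

No new definitions (proof-only module).
-/

noncomputable section

open Filter Topology Finset Literature.Probability.LatticeModels Literature.Probability.Percolation SimpleGraph

namespace Literature.Probability.RandomPlanarGeometry.SAW.HexBW

variable {y z : ℝ}

/-! ## §1 The law -/

/-- ★★★ **THE SEXTIC LAW: `s(s − y)(s − z) = yz` for `s = μ_1(y,z)²`, every `y, z > 0`.**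
[cite: BeatonBousquetMelouDeGierDuminilCopinGuttmann2014, §3.2 Proposition 6 (arXiv v5 p. 10: μ_T(y,z) = lim C_{T,n}(y,z)^{1/n})] -/
theorem stripMuY₂_one_sq_poly_eq (hy : 0 < y) (hz : 0 < z) :
    stripMuY₂ 1 y z ^ 2 * (stripMuY₂ 1 y z ^ 2 - y) * (stripMuY₂ 1 y z ^ 2 - z) = y * z :=
  le_antisymm (stripMuY₂_one_sq_poly_le hy hz (max_lt_stripMuY₂_one_sq hy hz).le) (mul_le_stripMuY₂_one_sq_poly hy hz)

/-- **The cubic `s ↦ s(s−y)(s−z)` is strictly increasing on `[max(y,z), ∞)`.** [cite: MadrasSlade1993, §1.2 (elementary)] -/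
theorem poly_lt_poly_of_lt {a b : ℝ} (ha : max y z ≤ a) (hab : a < b) (hy : 0 < y) :
    a * (a - y) * (a - z) < b * (b - y) * (b - z) := by
  have hya : y ≤ a := (le_max_left y z).trans ha
  have hza : z ≤ a := (le_max_right y z).trans ha
  have ha0 : 0 < a := hy.trans_le hya
  have hX : (a - y) * (a - z) ≤ (b - y) * (b - z) := by nlinarith
  have hX0 : 0 < (b - y) * (b - z) := mul_pos (by linarith) (by linarith)
  calc a * (a - y) * (a - z) = a * ((a - y) * (a - z)) := by ring
    _ ≤ a * ((b - y) * (b - z)) := mul_le_mul_of_nonneg_left hX ha0.le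
    _ < b * ((b - y) * (b - z)) := mul_lt_mul_of_pos_right hab hX0
    _ = b * (b - y) * (b - z) := by ring

/-- ★★ **Uniqueness: any root `s'` of `s(s−y)(s−z) = yz` with `max(y,z) ≤ s'` is `μ_1(y,z)²`.**
[cite: BeatonBousquetMelouDeGierDuminilCopinGuttmann2014, §3.2 Proposition 6 (arXiv v5 p. 10)] -/
theorem stripMuY₂_one_sq_eq_of_root (hy : 0 < y) (hz : 0 < z) {s' : ℝ} (hm : max y z ≤ s')
    (h : s' * (s' - y) * (s' - z) = y * z) : stripMuY₂ 1 y z ^ 2 = s' := by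
  have hlaw := stripMuY₂_one_sq_poly_eq hy hz
  have hmμ := (max_lt_stripMuY₂_one_sq hy hz).le
  rcases lt_trichotomy (stripMuY₂ 1 y z ^ 2) s' with hlt | heq | hgt
  · have := poly_lt_poly_of_lt hmμ hlt hy; linarith
  · exact heq
  · have := poly_lt_poly_of_lt hm hgt hy; linarith

/-- ★★ **`μ_1(y,z) ≤ ρ ↔ yz ≤ ρ²(ρ²−y)(ρ²−z)`** for every `ρ > 0` with `max(y,z) ≤ ρ²`.
[cite: BeatonBousquetMelouDeGierDuminilCopinGuttmann2014, §3.2 Proposition 6 (arXiv v5 p. 10)] -/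
theorem stripMuY₂_one_le_iff (hy : 0 < y) (hz : 0 < z) {ρ : ℝ} (hρ : 0 < ρ) (hm : max y z ≤ ρ ^ 2) :
    stripMuY₂ 1 y z ≤ ρ ↔ y * z ≤ ρ ^ 2 * (ρ ^ 2 - y) * (ρ ^ 2 - z) := by
  have hμ := stripMuY₂_pos 1 hy hz
  have hlaw := stripMuY₂_one_sq_poly_eq hy hz
  have hmμ := (max_lt_stripMuY₂_one_sq hy hz).le
  constructor
  · intro h
    rcases h.lt_or_eq with hlt | heq
    · have := poly_lt_poly_of_lt hmμ (pow_lt_pow_left₀ hlt hμ.le two_ne_zero) hy; linarith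
    · rw [← heq]; exact hlaw.ge
  · intro h
    by_contra hcon
    rw [not_le] at hcon
    have := poly_lt_poly_of_lt hm (pow_lt_pow_left₀ hcon hρ.le two_ne_zero) hy
    linarith

/-- ★★ **`ρ ≤ μ_1(y,z) ↔ ρ²(ρ²−y)(ρ²−z) ≤ yz`** for every `ρ > 0` with `max(y,z) ≤ ρ²`.
[cite: BeatonBousquetMelouDeGierDuminilCopinGuttmann2014, §3.2 Proposition 6 (arXiv v5 p. 10)] -/
theorem le_stripMuY₂_one_iff (hy : 0 < y) (hz : 0 < z) {ρ : ℝ} (hρ : 0 < ρ) (hm : max y z ≤ ρ ^ 2) :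
    ρ ≤ stripMuY₂ 1 y z ↔ ρ ^ 2 * (ρ ^ 2 - y) * (ρ ^ 2 - z) ≤ y * z := by
  have hμ := stripMuY₂_pos 1 hy hz
  have hlaw := stripMuY₂_one_sq_poly_eq hy hz
  have hmμ := (max_lt_stripMuY₂_one_sq hy hz).le
  constructor
  · intro h
    rcases h.lt_or_eq with hlt | heq
    · have := poly_lt_poly_of_lt hm (pow_lt_pow_left₀ hlt hρ.le two_ne_zero) hy; linarith
    · rw [heq]; exact hlaw.le
  · intro h
    by_contra hcon
    rw [not_le] at hcon
    have := poly_lt_poly_of_lt hmμ (pow_lt_pow_left₀ hcon hμ.le two_ne_zero) hy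
    linarith

/-! ## §2 Strict monotonicity in each fugacity -/

/-- ★★ **`μ_1(y,z)` is STRICTLY increasing in `y`** (`0 < y < y'`, `z > 0`); the printed Proposition 6 gives "non-decreasing".
[cite: BeatonBousquetMelouDeGierDuminilCopinGuttmann2014, §3.2 Proposition 6 (arXiv v5 p. 10: "non-decreasing in y and z")] -/
theorem stripMuY₂_one_strictMono_left (hy : 0 < y) (hz : 0 < z) {y' : ℝ} (hyy' : y < y') :
    stripMuY₂ 1 y z < stripMuY₂ 1 y' z := by
  have hy' : 0 < y' := hy.trans hyy'
  have hμ := stripMuY₂_pos 1 hy hz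
  have hμ' := stripMuY₂_pos 1 hy' hz
  set s := stripMuY₂ 1 y z ^ 2 with hs
  have hlaw := stripMuY₂_one_sq_poly_eq hy hz
  obtain ⟨hys, hzs⟩ := lt_stripMuY₂_one_sq₂ hy hz
  rw [← hs] at hlaw hys hzs
  have hs0 : 0 < s := hy.trans hys
  -- `s < μ_1(y',z)²`
  have hlt : s < stripMuY₂ 1 y' z ^ 2 := by
    rcases le_or_gt s y' with h1 | h1
    · exact lt_of_le_of_lt h1 (lt_stripMuY₂_one_sq₂ hy' hz).1
    · -- `s` is admissible for `(y', z)` with strict slack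
      have hslack : s * (s - y') * (s - z) < y' * z := by
        have h2 : s * (s - y') * (s - z) < s * (s - y) * (s - z) := by
          have : 0 < s * (s - z) := mul_pos hs0 (by linarith)
          nlinarith
        nlinarith
      have hle := le_stripMuY₂_one_sq hy' hz h1 hslack.le
      refine lt_of_le_of_ne hle fun heq => ?_
      have hlaw' := stripMuY₂_one_sq_poly_eq hy' hz
      rw [← heq] at hlaw'
      linarith
  exact lt_of_pow_lt_pow_left₀ 2 hμ'.le hlt

/-- ★★ **`μ_1(y,z)` is STRICTLY increasing in `z`** (by the symmetry `μ_1(y,z) = μ_1(z,y)`).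
[cite: BeatonBousquetMelouDeGierDuminilCopinGuttmann2014, §3.2 Proposition 6 (arXiv v5 p. 10: "By the symmetry of bridges, μ_T(y,z) = μ_T(z,y)")] -/
theorem stripMuY₂_one_strictMono_right (hy : 0 < y) (hz : 0 < z) {z' : ℝ} (hzz' : z < z') :
    stripMuY₂ 1 y z < stripMuY₂ 1 y z' := by
  rw [stripMuY₂_symm 1 y z, stripMuY₂_symm 1 y z']
  exact stripMuY₂_one_strictMono_left hz hy hzz'

/-! ## §3 One weighted wall: the printed width-one rate `μ_1(y,1) = stripMuY₀ 1 y` -/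

/-- ★★ **`s(s − y)(s − 1) = y` for `s = μ_1(y,1)²`, EVERY `y > 0`** (repulsive `y < 1` included).
[cite: BeatonBousquetMelouDeGierDuminilCopinGuttmann2014, §3.2 Propositions 6–7 (arXiv v5 pp. 10–11: μ_T(1,y) = μ_T(y,1))] -/
theorem stripMuY₀_one_sq_poly_eq (hy : 0 < y) :
    stripMuY₀ 1 y ^ 2 * (stripMuY₀ 1 y ^ 2 - y) * (stripMuY₀ 1 y ^ 2 - 1) = y := by
  have h := stripMuY₂_one_sq_poly_eq hy one_pos
  rw [stripMuY₂_one_right, mul_one] at h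
  exact h

/-- `μ_1(y,1)²` is the unique root of `s(s−y)(s−1) = y` above `max(y,1)`. [cite: BeatonBousquetMelouDeGierDuminilCopinGuttmann2014, §3.2 Propositions 6–7 (arXiv v5 pp. 10–11)] -/
theorem stripMuY₀_one_sq_eq_of_root (hy : 0 < y) {s' : ℝ} (hm : max y 1 ≤ s') (h : s' * (s' - y) * (s' - 1) = y) :
    stripMuY₀ 1 y ^ 2 = s' := by
  rw [← stripMuY₂_one_right]
  exact stripMuY₂_one_sq_eq_of_root hy one_pos hm (by rw [mul_one]; exact h)

/-- **`s − y = y/(s(s−1))`** for `s = μ_1(y,1)²` (`y > 0`). [cite: BeatonBousquetMelouDeGierDuminilCopinGuttmann2014, §3.2 Propositions 6–7 (arXiv v5 pp. 10–11)] -/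
theorem stripMuY₀_one_sq_sub_eq (hy : 0 < y) :
    stripMuY₀ 1 y ^ 2 - y = y / (stripMuY₀ 1 y ^ 2 * (stripMuY₀ 1 y ^ 2 - 1)) := by
  have hlaw := stripMuY₀_one_sq_poly_eq hy
  have hm := max_lt_stripMuY₀_one_sq hy
  have h1 : 1 < stripMuY₀ 1 y ^ 2 := lt_of_le_of_lt (le_max_right y 1) hm
  have hpos : 0 < stripMuY₀ 1 y ^ 2 * (stripMuY₀ 1 y ^ 2 - 1) := mul_pos (by linarith) (by linarith)
  rw [eq_div_iff hpos.ne']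
  linarith [hlaw]

/-- ★ **`y + 1/(y+1) ≤ μ_1(y,1)² ≤ y + 1/(y−1)` for every `y ≥ 2`**: the one-wall width-one correction is `1/y + O(1/y²)` — the
second-order coefficient `1` of the half-plane law. [cite: BeatonBousquetMelouDeGierDuminilCopinGuttmann2014, §3.2 Propositions 6–7 (arXiv v5 pp. 10–11)] -/
theorem stripMuY₀_one_sq_mem_Icc (hy : 2 ≤ y) :
    stripMuY₀ 1 y ^ 2 ∈ Set.Icc (y + 1 / (y + 1)) (y + 1 / (y - 1)) := by
  have hy0 : 0 < y := by linarith
  set s := stripMuY₀ 1 y ^ 2 with hs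
  have hlaw := stripMuY₀_one_sq_poly_eq hy0
  have hm := max_lt_stripMuY₀_one_sq hy0
  rw [← hs] at hlaw hm
  have hys : y < s := lt_of_le_of_lt (le_max_left y 1) hm
  have h1s : 1 < s := lt_of_le_of_lt (le_max_right y 1) hm
  -- upper: `s(s−1) > y(y−1)` hence `s − y = y/(s(s−1)) < 1/(y−1)`
  have hup : s ≤ y + 1 / (y - 1) := by
    have hsub : (s - y) * (s * (s - 1)) = y := by linarith [hlaw]
    have hprod : y * (y - 1) ≤ s * (s - 1) := by nlinarith
    rw [← sub_le_iff_le_add', le_div_iff₀ (by linarith)]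
    nlinarith
  refine ⟨?_, hup⟩
  -- lower: `s(s−1) ≤ u(u−1) ≤ y(y+1)` with `u = y + 1/(y−1)`, hence `s − y = y/(s(s−1)) ≥ 1/(y+1)`
  have hy1 : 0 < y - 1 := by linarith
  have hu : s * (s - 1) ≤ y * (y + 1) := by
    have e : (y + 1 / (y - 1)) * (y + 1 / (y - 1) - 1) ≤ y * (y + 1) := by
      rw [show y + 1 / (y - 1) = (y * (y - 1) + 1) / (y - 1) by field_simp,
        show (y * (y - 1) + 1) / (y - 1) - 1 = (y * (y - 1) + 1 - (y - 1)) / (y - 1) by field_simp,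
        div_mul_div_comm, div_le_iff₀ (by positivity)]
      nlinarith [mul_nonneg hy1.le hy1.le, mul_nonneg (mul_nonneg hy1.le hy1.le) (by linarith : (0:ℝ) ≤ y - 2)]
    calc s * (s - 1) ≤ (y + 1 / (y - 1)) * (y + 1 / (y - 1) - 1) := by nlinarith
      _ ≤ y * (y + 1) := e
  rw [← le_sub_iff_add_le', div_le_iff₀ (by linarith)]
  nlinarith [hlaw]

/-! ## §4 Consistency at `z = y` -/

/-- At `z = y` the sextic factors: `s(s − y)² = y²`, i.e. `μ_1(y,y)(μ_1(y,y)² − y) = y` — the cubic law `μ³ = yμ + y` of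
`HexSAWBrickWallStripFugacityWidthOneExact.lean`, re-derived. [cite: BeatonBousquetMelouDeGierDuminilCopinGuttmann2014, §3.2 Proposition 6 (arXiv v5 p. 10)] -/
theorem stripMuY₂_one_self_sq_poly_eq (hy : 0 < y) :
    stripMuY₂ 1 y y * (stripMuY₂ 1 y y ^ 2 - y) = y := by
  have hμ := stripMuY₂_pos 1 hy hy
  have hlaw := stripMuY₂_one_sq_poly_eq hy hy
  have hys := (lt_stripMuY₂_one_sq₂ hy hy).1
  have hpos : 0 < stripMuY₂ 1 y y * (stripMuY₂ 1 y y ^ 2 - y) := mul_pos hμ (by linarith)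
  have hsq : (stripMuY₂ 1 y y * (stripMuY₂ 1 y y ^ 2 - y)) ^ 2 = y ^ 2 := by nlinarith [hlaw]
  exact (pow_left_inj₀ hpos.le hy.le two_ne_zero).1 hsq

/-! ## §5 The one-cell strip versus every wider strip at UNEQUAL fugacities

`HexSAWBrickWallStripFugacityWidthOneExact.lean` (Part D) has `μ_T(y,y) < μ_1(y,y)` for `T ≥ 2`, `y ≥ 9`.  With the exact law the
comparison extends to a band of unequal wall weights: by monotonicity (`stripMuY₂_mono_right`) and the uniform windows of
`HexSAWBrickWallStripFugacityTwoWallOrder.lean` (`μ_T(y,y)² ≤ y + 6/y` for `T ≥ 3`, `y ≥ 25`; `≤ y + 4/(√y − 1)` for `T ≥ 2`, `y ≥ 4`),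
`μ_T(y,z) ≤ μ_T(y,y) ≤ ρ` while `ρ < μ_1(y,z)` as soon as `ρ²(ρ²−y)(ρ²−z) < yz` (`stripMuY₂_one_le_iff`). -/

/-- ★★ **Width ≥ 3: if `y ≥ 25` and `6 ≤ z ≤ y` then `μ_T(y,z) < μ_1(y,z)` for every `T ≥ 3`** — the one-cell slit beats every wider
strip once the weaker wall has weight at least `6`. [cite: BeatonBousquetMelouDeGierDuminilCopinGuttmann2014, §3.2 Proposition 6 (arXiv v5 p. 10: μ_T(y,z)) and Proposition 7 (p. 11: monotonicity in T for one wall)] -/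
theorem stripMuY₂_lt_one_of_three_le {T : ℕ} (hT : 3 ≤ T) (hy : 25 ≤ y) (hz : 6 ≤ z) (hzy : z ≤ y) :
    stripMuY₂ T y z < stripMuY₂ 1 y z := by
  have hy0 : 0 < y := by linarith
  have hz0 : 0 < z := by linarith
  set ρ : ℝ := Real.sqrt (y + 6 / y) with hρdef
  have hρ2 : ρ ^ 2 = y + 6 / y := by rw [hρdef, Real.sq_sqrt (by positivity)]
  have hρ0 : 0 < ρ := Real.sqrt_pos.2 (by positivity)
  -- `μ_T(y,z) ≤ μ_T(y,y) ≤ ρ`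
  have h1 : stripMuY₂ T y z ≤ ρ := by
    refine (stripMuY₂_mono_right T hy0 hz0 hzy).trans ?_
    have h := stripMuY₂_self_sq_le_of_three_le hT hy
    rw [← hρ2] at h
    exact (pow_le_pow_iff_left₀ (stripMuY₂_pos T hy0 hy0).le hρ0.le two_ne_zero).1 h
  -- `ρ < μ_1(y,z)`: `ρ²(ρ²−y)(ρ²−z) < yz`
  have hm : max y z ≤ ρ ^ 2 := by
    rw [hρ2, max_le_iff]; exact ⟨by linarith [div_pos (by norm_num : (0:ℝ) < 6) hy0], by linarith [div_pos (by norm_num : (0:ℝ) < 6) hy0]⟩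
  have hlt : ρ ^ 2 * (ρ ^ 2 - y) * (ρ ^ 2 - z) < y * z := by
    rw [hρ2]
    have e : (y + 6 / y) * (y + 6 / y - y) * (y + 6 / y - z) = 6 * (y ^ 2 + 6) * (y ^ 2 + 6 - z * y) / y ^ 3 := by
      field_simp; ring
    rw [e, div_lt_iff₀ (by positivity)]
    -- at `z = 6` the inequality is `6(y²+6)(y²−6y+6) < 6y⁴`; the left side decreases and the right side increases in `z`
    have h2 : (y ^ 2 + 6 - z * y) ≤ y ^ 2 + 6 - 6 * y := by nlinarith
    have h3 : 6 * (y ^ 2 + 6) * (y ^ 2 + 6 - z * y) ≤ 6 * (y ^ 2 + 6) * (y ^ 2 + 6 - 6 * y) :=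
      mul_le_mul_of_nonneg_left h2 (by positivity)
    have h4 : 6 * (y ^ 2 + 6) * (y ^ 2 + 6 - 6 * y) < 6 * y * y ^ 3 := by nlinarith
    have h5 : 6 * y * y ^ 3 ≤ y * z * y ^ 3 := by
      have : 0 ≤ y * y ^ 3 := by positivity
      nlinarith
    linarith
  have h2 : ρ < stripMuY₂ 1 y z := by
    by_contra hcon
    rw [not_lt] at hcon
    have := (stripMuY₂_one_le_iff hy0 hz0 hρ0 hm).1 hcon
    linarith
  exact lt_of_le_of_lt h1 h2

/-- The same with the walls exchanged: `6 ≤ y ≤ z`, `25 ≤ z` ⇒ `μ_T(y,z) < μ_1(y,z)` (`T ≥ 3`).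
[cite: BeatonBousquetMelouDeGierDuminilCopinGuttmann2014, §3.2 Proposition 6 (arXiv v5 p. 10: "μ_T(y,z) = μ_T(z,y)")] -/
theorem stripMuY₂_lt_one_of_three_le' {T : ℕ} (hT : 3 ≤ T) (hz : 25 ≤ z) (hy : 6 ≤ y) (hyz : y ≤ z) :
    stripMuY₂ T y z < stripMuY₂ 1 y z := by
  rw [stripMuY₂_symm T y z, stripMuY₂_symm 1 y z]
  exact stripMuY₂_lt_one_of_three_le hT hz hy hyz

/-- ★★ **Width ≥ 2: if `y ≥ 25` and `5√y ≤ z ≤ y` then `μ_T(y,z) < μ_1(y,z)` for every `T ≥ 2`** (the window for `T = 2` is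
`y + 4/(√y−1)`, so the band is narrower). [cite: BeatonBousquetMelouDeGierDuminilCopinGuttmann2014, §3.2 Proposition 6 (arXiv v5 p. 10: μ_T(y,z))] -/
theorem stripMuY₂_lt_one_of_two_le {T : ℕ} (hT : 2 ≤ T) (hy : 25 ≤ y) (hz : 5 * Real.sqrt y ≤ z) (hzy : z ≤ y) :
    stripMuY₂ T y z < stripMuY₂ 1 y z := by
  have hy0 : 0 < y := by linarith
  set q := Real.sqrt y with hq
  have hq5 : 5 ≤ q := by
    rw [hq, show (5:ℝ) = Real.sqrt 25 by rw [show (25:ℝ) = 5 ^ 2 by norm_num, Real.sqrt_sq (by norm_num)]]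
    exact Real.sqrt_le_sqrt hy
  have hqq : q ^ 2 = y := by rw [hq, Real.sq_sqrt hy0.le]
  have hz0 : 0 < z := by nlinarith
  set ε : ℝ := 4 / (q - 1) with hε
  have hq1 : 0 < q - 1 := by linarith
  have hε0 : 0 < ε := by rw [hε]; positivity
  have hε1 : ε ≤ 1 := by rw [hε, div_le_one hq1]; linarith
  set ρ : ℝ := Real.sqrt (y + ε) with hρdef
  have hρ2 : ρ ^ 2 = y + ε := by rw [hρdef, Real.sq_sqrt (by positivity)]
  have hρ0 : 0 < ρ := Real.sqrt_pos.2 (by positivity)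
  have h1 : stripMuY₂ T y z ≤ ρ := by
    refine (stripMuY₂_mono_right T hy0 hz0 hzy).trans ?_
    have h := stripMuY₂_self_sq_le_of_two_le (y := y) hT (by linarith)
    rw [← hq, ← hε, ← hρ2] at h
    exact (pow_le_pow_iff_left₀ (stripMuY₂_pos T hy0 hy0).le hρ0.le two_ne_zero).1 h
  have hm : max y z ≤ ρ ^ 2 := by rw [hρ2, max_le_iff]; exact ⟨by linarith, by linarith⟩
  have hlt : ρ ^ 2 * (ρ ^ 2 - y) * (ρ ^ 2 - z) < y * z := by
    rw [hρ2, show y + ε - y = ε by ring]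
    -- `(y+ε)·ε·(y+ε−z) ≤ (y+1)(y+1−5q)·ε < 5yq·... = y·(5q) ≤ yz`
    have hA : (y + ε) * ε * (y + ε - z) ≤ (y + 1) * (y + 1 - 5 * q) * ε := by
      have h3 : y + ε - z ≤ y + 1 - 5 * q := by linarith
      have h4 : 0 ≤ y + ε - z := by linarith
      calc (y + ε) * ε * (y + ε - z) = ((y + ε) * (y + ε - z)) * ε := by ring
        _ ≤ ((y + 1) * (y + 1 - 5 * q)) * ε := by
            refine mul_le_mul_of_nonneg_right ?_ hε0.le
            exact mul_le_mul (by linarith) h3 h4 (by linarith)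
        _ = (y + 1) * (y + 1 - 5 * q) * ε := by ring
    have hB : (y + 1) * (y + 1 - 5 * q) * ε < y * (5 * q) := by
      rw [hε, show (y + 1) * (y + 1 - 5 * q) * (4 / (q - 1)) = 4 * ((y + 1) * (y + 1 - 5 * q)) / (q - 1) by ring,
        div_lt_iff₀ hq1, ← hqq]
      nlinarith [pow_pos (show (0:ℝ) < q by linarith) 3, pow_pos (show (0:ℝ) < q by linarith) 4]
    have hC : y * (5 * q) ≤ y * z := mul_le_mul_of_nonneg_left hz hy0.le
    linarith
  have h2 : ρ < stripMuY₂ 1 y z := by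
    by_contra hcon
    rw [not_lt] at hcon
    have := (stripMuY₂_one_le_iff hy0 hz0 hρ0 hm).1 hcon
    linarith
  exact lt_of_le_of_lt h1 h2

/-- The same with the walls exchanged: `25 ≤ z`, `5√z ≤ y ≤ z` ⇒ `μ_T(y,z) < μ_1(y,z)` (`T ≥ 2`).
[cite: BeatonBousquetMelouDeGierDuminilCopinGuttmann2014, §3.2 Proposition 6 (arXiv v5 p. 10: "μ_T(y,z) = μ_T(z,y)")] -/
theorem stripMuY₂_lt_one_of_two_le' {T : ℕ} (hT : 2 ≤ T) (hz : 25 ≤ z) (hy : 5 * Real.sqrt z ≤ y) (hyz : y ≤ z) :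
    stripMuY₂ T y z < stripMuY₂ 1 y z := by
  rw [stripMuY₂_symm T y z, stripMuY₂_symm 1 y z]
  exact stripMuY₂_lt_one_of_two_le hT hz hy hyz

/-! ## §6 Explicit envelopes: `max(y,z) + yz/((max+√min)(max−min+√min)) < μ_1(y,z)² < max(y,z) + √min(y,z)` -/

/-- ★ **Upper envelope `μ_1(y,z)² < max(y,z) + √(min(y,z))`** for all `y, z > 0` (at `z = y`: `μ_1(y,y)² < y + √y`): from
`(s − max)² ≤ (s−y)(s−z) = yz/s < yz/max = min`. [cite: BeatonBousquetMelouDeGierDuminilCopinGuttmann2014, §3.2 Proposition 6 (arXiv v5 p. 10) and §3.1 Proposition 5 (p. 10 ll. 2–3: "μ(y) ∼ √y")] -/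
theorem stripMuY₂_one_sq_lt_max_add_sqrt_min (hy : 0 < y) (hz : 0 < z) :
    stripMuY₂ 1 y z ^ 2 < max y z + Real.sqrt (min y z) := by
  wlog hzy : z ≤ y generalizing y z
  · have h := this hz hy (le_of_not_ge hzy)
    rwa [stripMuY₂_symm, max_comm, min_comm] at h
  rw [max_eq_left hzy, min_eq_right hzy]
  set s := stripMuY₂ 1 y z ^ 2 with hs
  have hlaw := stripMuY₂_one_sq_poly_eq hy hz
  obtain ⟨hys, hzs⟩ := lt_stripMuY₂_one_sq₂ hy hz
  rw [← hs] at hlaw hys hzs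
  have hs0 : 0 < s := hy.trans hys
  -- `(s − y)² · s ≤ (s − y)(s − z) s = yz < s z`, hence `(s − y)² < z`
  have h1 : (s - y) ^ 2 < z := by
    have h2a : (s - y) * (s - y) ≤ (s - y) * (s - z) := mul_le_mul_of_nonneg_left (by linarith) (by linarith)
    have h2 : (s - y) ^ 2 * s ≤ y * z := by
      have := mul_le_mul_of_nonneg_right h2a hs0.le
      nlinarith [hlaw]
    have h3 : y * z < s * z := mul_lt_mul_of_pos_right hys hz
    nlinarith
  have h4 : s - y < Real.sqrt z := by
    rw [← Real.sqrt_sq (by linarith : (0:ℝ) ≤ s - y)]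
    exact Real.sqrt_lt_sqrt (sq_nonneg _) h1
  linarith

/-- ★ **Lower envelope `max(y,z) + yz/((max + √min)(max − min + √min)) < μ_1(y,z)²`** for all `y, z > 0`: from
`s − max = yz/(s(s − min))` and the upper envelope. [cite: BeatonBousquetMelouDeGierDuminilCopinGuttmann2014, §3.2 Proposition 6 (arXiv v5 p. 10)] -/
theorem max_add_lt_stripMuY₂_one_sq (hy : 0 < y) (hz : 0 < z) :
    max y z + y * z / ((max y z + Real.sqrt (min y z)) * (max y z - min y z + Real.sqrt (min y z))) <
      stripMuY₂ 1 y z ^ 2 := by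
  have hup := stripMuY₂_one_sq_lt_max_add_sqrt_min hy hz
  wlog hzy : z ≤ y generalizing y z
  · have h := this hz hy (by rwa [stripMuY₂_symm, max_comm, min_comm]) (le_of_not_ge hzy)
    rwa [stripMuY₂_symm, max_comm, min_comm, mul_comm z y] at h
  rw [max_eq_left hzy, min_eq_right hzy] at hup ⊢
  set s := stripMuY₂ 1 y z ^ 2 with hs
  have hlaw := stripMuY₂_one_sq_poly_eq hy hz
  obtain ⟨hys, hzs⟩ := lt_stripMuY₂_one_sq₂ hy hz
  rw [← hs] at hlaw hys hzs
  have hs0 : 0 < s := hy.trans hys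
  have hq : 0 < Real.sqrt z := Real.sqrt_pos.2 hz
  have hden : 0 < (y + Real.sqrt z) * (y - z + Real.sqrt z) := mul_pos (by linarith) (by linarith)
  -- `s − y = yz/(s(s−z))` and `s(s − z) < (y + √z)(y − z + √z)`
  have h1 : s * (s - z) < (y + Real.sqrt z) * (y - z + Real.sqrt z) :=
    mul_lt_mul'' hup (by linarith) hs0.le (by linarith)
  have h2 : (s - y) * (s * (s - z)) = y * z := by linarith [hlaw]
  rw [← lt_sub_iff_add_lt', div_lt_iff₀ hden]
  have h3 := mul_lt_mul_of_pos_left h1 (by linarith : 0 < s - y)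
  linarith

end Literature.Probability.RandomPlanarGeometry.SAW.HexBW
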